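/-
Copyright (c) 2026 the pub-hodgecm-mathlib formalisation cell (harness21).  Prover seat hodgecm-mathlib-LH7-p02 (g6): LH4-plan (g7) WORD #10∕#16 DEAL (h) «LOCALFIELDS GATE (I4),
part L1» — the TRACE-FRAME (2-free) twin of ★ FILE 10 of the story `UnramifiedQuadraticNorm*` (F0P3b-p01 (g6) under A-p03 (g24)); census
`F0/P3c/LH7/LH7-p02/g6/h/CENSUS-h-ShiftPairsTrace.v1.LH7p02g6.md` sha16 10d40da9480eff08 (FINDING #13 of the LH4 (g7) record); 2026-09-02.
-/
import Literature.NumberTheory.LocalFields.UnramifiedQuadraticNormResidueShiftPairsTrace       -- FILE 8′ (this hand): §1 frame splitting + unit claim, `natCard_pairs_norm_congr_shift_frame`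
import Literature.NumberTheory.LocalFields.UnramifiedQuadraticNormResidueShiftHighPairs        -- ★ FILE 10 (brings FILE 9 `natCard_norm_congr_shift_exists`)
import HarnessLib

/-!
# The pair count of Flicker's Prop. 13, case (e), precision beyond the level, in the TRACE FRAME (every residue characteristic):
# `#{(u, y) : σ̄y = y, ∃ w ≡ (uσ̄u)⁻¹ + e + y·g, ϖ^j ∣ N w − (e² − 1)} = q^{m−1}(q+1) · (q+1)q^{2m−j−1}` — FILE 10′ of the story `UnramifiedQuadraticNorm*`
(Flicker (1998), *Elementary proof of the fundamental lemma for a unitary group*, Prop. 13 p. 93, case (e); Serre, *Local Fields*, V §2)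

Topic `NumberTheory/LocalFields`, namespace `Literature.NumberTheory.LocalFields.UnramifiedQuadraticNorm`.  THEOREMS ONLY: no definition, no named fact, no instance, no
notation, no `sorry`; kernel lane `--supports stmt-HodgeConjecture-24833`.  Cell `pub/hodgecm-mathlib` (D-0151), crux H413; LH4-plan (g7) DEAL (h) «LOCALFIELDS GATE (I4), part L1»,
sequel of FILE 8′ `UnramifiedQuadraticNormResidueShiftPairsTrace` (split at the cell's 400-line rule, as ★ FILE 8 ∕ FILE 10 are): the `∃ w`-lift predicate at precision
`m < j ≤ m + ℓ`, frame currency `(u, y)` with `ȳ` FIXED on the frame line `ḡ` (`σg − g ∈ Rˣ`), `1 ≤ ℓ`; RHS = ★ FILE 10's VERBATIM.  Route = ★ FILE 10's with the three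
`2`-reads replaced by FILE 8′ §1 (`fixed_add_mul_frame_inj`, `exists_fixed_add_mul_frame_eq`, `isUnit_fixed_sub_of_norm_sub_frame`); the `z`-count is ★ FILE 9
`natCard_norm_congr_shift_exists` (2-free).  HC_CM is proved only modulo the 7 printed citations (2 remaining named inputs: hLiu418 = stmt-HodgeConjecture-24832, h413 =
stmt-HodgeConjecture-24833) until rung 0 closes; count-neutral ((D-UNR) stays PRINT by D74′); proves no letter.

* **`natCard_pairs_norm_congr_shift_frame_exists`** (`2ℓ < j ≤ m + ℓ`, `1 ≤ ℓ`) = ★ `natCard_pairs_norm_congr_shift_exists` with `σ̄x = −x ↦ σ̄y = y`, `+ x ↦ + y·ḡ`,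
  `h2 ↦ hg + hℓ`.  The tame ★ head is NOT restated.

## References
* [Flicker1998UnitaryFL] Y. Z. Flicker, *Elementary proof of the fundamental lemma for a unitary group*, Canad. J. Math. 50 (1998), 74–98: Prop. 13 p. 93 (case (e)).
* [Serre1979] J.-P. Serre, *Local Fields*, GTM 67 (1979), Ch. V §2 Prop. 2–3.
-/

set_option autoImplicit false

namespace Literature.NumberTheory.LocalFields.UnramifiedQuadraticNorm

open Literature.LinearAlgebra.Matrix.HermitianFormsHensel Literature.NumberTheory.GaloisRepresentations IsLocalRing

universe u

variable {R : Type u} [CommRing R] (σ : R →+* R)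

section Count

variable [IsDomain R] [IsDiscreteValuationRing R] [Finite (ResidueField R)] [IsAdicComplete (maximalIdeal R) R]
  (hσ : ∀ a, σ (σ a) = a) {a : R} (ha : IsUnit (σ a - a)) {q : ℕ} (hq : Nat.card (ResidueField R) = q ^ 2) {g : R} (hg : IsUnit (σ g - g))

include ha hq hg in
/-- **THE PAIR COUNT OF PROP. 13, CASE (e), precision beyond the level, IN THE FRAME CURRENCY — EVERY RESIDUE CHARACTERISTIC** (`∃`-lift predicate): for `1 ≤ ℓ`,
`2ℓ < j ≤ m + ℓ`, `1 ≤ m`, `e ∈ R^σ` with `e² − 1 = ϖ^{2ℓ}γ` (`γ ∈ (R^σ)^×`) and a frame element `g` (`σg − g ∈ Rˣ`),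
`#{(u, y) ∈ (R ⧸ 𝔪^m)² : u ∈ (R⧸𝔪^m)^×, σ̄y = y, ∃ w ≡ (uσ̄u)⁻¹ + ē + y·ḡ with ϖ^j ∣ N(w) − ϖ^{2ℓ}γ} = q^{m−1}(q+1) · (q^{(m−ℓ)−(j−2ℓ)} · q^{m−ℓ−1}(q+1))` — the ★ FILE 10 value VERBATIM, over
★ `natCard_norm_congr_shift_exists`.  Trace-frame twin of ★ `natCard_pairs_norm_congr_shift_exists (h2)`. [cite: Flicker1998UnitaryFL, Prop. 13 p. 93] [cite: Serre1979, Ch. V §2 Prop. 3] -/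
theorem natCard_pairs_norm_congr_shift_frame_exists {p : R} (hp : Irreducible p) (hσp : σ p = p) {m j ℓ : ℕ} (hm : 1 ≤ m) (hℓ : 1 ≤ ℓ) (hj : 2 * ℓ < j)
    (hjm : j ≤ m + ℓ) {e γ : R} (hσe : σ e = e) (hγ : IsUnit γ) (hσγ : σ γ = γ) (hec : e ^ 2 - 1 = p ^ (2 * ℓ) * γ) :
    Nat.card {uy : (R ⧸ maximalIdeal R ^ m) × (R ⧸ maximalIdeal R ^ m) // IsUnit uy.1 ∧
      Ideal.quotientMap (maximalIdeal R ^ m) σ (maximalIdeal_pow_le_comap σ hσ m) uy.2 = uy.2 ∧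
      ∃ w : R, Ideal.Quotient.mk (maximalIdeal R ^ m) w =
          Ring.inverse (uy.1 * Ideal.quotientMap (maximalIdeal R ^ m) σ (maximalIdeal_pow_le_comap σ hσ m) uy.1) +
            Ideal.Quotient.mk (maximalIdeal R ^ m) e + uy.2 * Ideal.Quotient.mk (maximalIdeal R ^ m) g ∧
        p ^ j ∣ w * σ w - p ^ (2 * ℓ) * γ} =
      (q ^ (m - 1) * (q + 1)) * (q ^ ((m - ℓ) - (j - 2 * ℓ)) * (q ^ ((m - ℓ) - 1) * (q + 1))) := by
  classical
  haveI := CompleteLocalRing.finite_quotient_maximalIdeal_pow (R := R) m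
  set A := R ⧸ maximalIdeal R ^ m with hA
  set τ := Ideal.quotientMap (maximalIdeal R ^ m) σ (maximalIdeal_pow_le_comap σ hσ m) with hτ
  have hττ : ∀ z, τ (τ z) = z := quotientMap_quotientMap σ hσ m
  have hτmk : ∀ w : R, τ (Ideal.Quotient.mk _ w) = Ideal.Quotient.mk _ (σ w) := fun w => Ideal.quotientMap_mk
  haveI : Nontrivial A := nontrivial_quotient_pow (R := R) hm
  haveI : IsLocalRing A := IsLocalRing.of_surjective' (Ideal.Quotient.mk (maximalIdeal R ^ m)) Ideal.Quotient.mk_surjective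
  -- the frame class `ḡ` and its unit `τḡ − ḡ`
  set gA : A := Ideal.Quotient.mk _ g with hgA
  have hgAu : IsUnit (τ gA - gA) := by
    have h := hg.map (Ideal.Quotient.mk (maximalIdeal R ^ m))
    rwa [map_sub, ← hτmk] at h
  have hτinv : ∀ w : Aˣ, τ (w : A) = w → τ (↑w⁻¹ : A) = ↑w⁻¹ := fun w hw => by
    have h1 : τ (↑w⁻¹ : A) * (w : A) = 1 := by rw [← hw, ← map_mul, Units.inv_mul, map_one]
    calc τ (↑w⁻¹ : A) = τ ↑w⁻¹ * ((w : A) * ↑w⁻¹) := by rw [Units.mul_inv, mul_one]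
      _ = ↑w⁻¹ := by rw [← mul_assoc, h1, one_mul]
  have hq0 : 0 < q := by
    rcases Nat.eq_zero_or_pos q with h0 | h0
    · exfalso
      have h1 : 0 < Nat.card (ResidueField R) := Nat.card_pos
      rw [hq, h0] at h1; simp at h1
    · exact h0
  set eA : A := Ideal.Quotient.mk _ e with heA
  have hτe : τ eA = eA := by rw [heA, hτmk, hσe]
  -- `ē² − 1` is a non-unit (`1 ≤ ℓ`)
  have he1 : ¬ IsUnit (eA ^ 2 - 1) := by
    intro hu
    have hcl : eA ^ 2 - 1 = Ideal.Quotient.mk (maximalIdeal R ^ m) (p ^ (2 * ℓ) * γ) := by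
      rw [← hec, map_sub, map_pow, map_one, heA]
    rw [hcl] at hu
    have hu' : IsUnit (p ^ (2 * ℓ) * γ) := isUnit_of_isUnit_mk_pow (R := R) hm hu
    have hpu : IsUnit (p ^ (2 * ℓ)) := isUnit_of_mul_isUnit_left hu'
    exact hp.not_isUnit ((isUnit_pow_iff (by omega)).1 hpu)
  -- the norm, the map `Z`, the predicate `G`
  let Nm : A → A := fun u => u * τ u
  have hNfix : ∀ u, τ (Nm u) = Nm u := fun u => by simp only [Nm, map_mul, hττ, mul_comm]
  let α := {uy : A × A // IsUnit uy.1 ∧ τ uy.2 = uy.2}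
  let Z : α → A := fun w => Ring.inverse (Nm w.1.1) + eA + w.1.2 * gA
  let G : A → Prop := fun z => ∃ w : R, Ideal.Quotient.mk (maximalIdeal R ^ m) w = z ∧ p ^ j ∣ w * σ w - p ^ (2 * ℓ) * γ
  haveI : Finite α := Subtype.finite
  -- Step 0: reshuffle to `{w : α // G (Z w)}`
  have e0 : {uy : A × A // IsUnit uy.1 ∧ τ uy.2 = uy.2 ∧ G (Ring.inverse (Nm uy.1) + eA + uy.2 * gA)} ≃ {w : α // G (Z w)} :=
    { toFun := fun w => ⟨⟨w.1, w.2.1, w.2.2.1⟩, w.2.2.2⟩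
      invFun := fun w => ⟨w.1.1, w.1.2.1, w.1.2.2, w.2⟩
      left_inv := fun w => rfl
      right_inv := fun w => rfl }
  rw [Nat.card_congr e0]
  -- fixed parts: `Ring.inverse (Nm u) + e` is `τ`-fixed
  have hfixZ : ∀ w : α, τ (Ring.inverse (Nm w.1.1) + eA) = Ring.inverse (Nm w.1.1) + eA := fun w => by
    rw [map_add, hτe]
    congr 1
    have hu : IsUnit (Nm w.1.1) := w.2.1.mul (w.2.1.map τ)
    rw [← hu.unit_spec, Ring.inverse_unit]
    exact hτinv hu.unit (by rw [hu.unit_spec]; exact hNfix _)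
  -- Step 1: fibres of `Z` are norm fibres
  have hfibre : ∀ z ∈ Set.range Z, Nat.card {w : α // Z w = z} = q ^ (m - 1) * (q + 1) := by
    rintro _ ⟨w₀, rfl⟩
    obtain ⟨⟨u₀, y₀⟩, hu₀, hy₀⟩ := w₀
    have hN₀ : IsUnit (Nm u₀) := hu₀.mul (hu₀.map τ)
    obtain ⟨v, hv⟩ := Ideal.Quotient.mk_surjective u₀
    have hvu : IsUnit v := isUnit_of_isUnit_mk_pow (R := R) hm (by rw [hv]; exact hu₀)
    have hr : Ideal.Quotient.mk (maximalIdeal R ^ m) (v * σ v) = Nm u₀ := by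
      show _ = u₀ * τ u₀; rw [← hv, hτmk, map_mul]
    have hrunit : IsUnit (v * σ v) := hvu.mul (hvu.map σ)
    have hσr : σ (v * σ v) = v * σ v := by rw [map_mul, hσ, mul_comm]
    rw [← natCard_norm_fibre_quotient_pow σ hσ ha hq hm hrunit hσr]
    refine Nat.card_congr
      { toFun := fun w => ⟨w.1.1.1, ?_⟩
        invFun := fun u => ⟨⟨(u.1, y₀), ?_, hy₀⟩, ?_⟩
        left_inv := fun w => ?_
        right_inv := fun u => rfl }
    · have h := w.2
      change Ring.inverse (Nm w.1.1.1) + eA + w.1.1.2 * gA = Ring.inverse (Nm u₀) + eA + y₀ * gA at h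
      obtain ⟨hF, -⟩ := fixed_add_mul_frame_inj τ hgAu (hfixZ w.1) (hfixZ ⟨(u₀, y₀), hu₀, hy₀⟩) w.1.2.2 hy₀ h
      have hinv : Ring.inverse (Nm w.1.1.1) = Ring.inverse (Nm u₀) := add_right_cancel hF
      have hNw : IsUnit (Nm w.1.1.1) := w.1.2.1.mul (w.1.2.1.map τ)
      have key : Nm w.1.1.1 = Nm u₀ := by
        rw [← Ring.inverse_inverse hNw, hinv, Ring.inverse_inverse hN₀]
      show w.1.1.1 * τ w.1.1.1 = Ideal.Quotient.mk _ (v * σ v)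
      rw [hr]; exact key
    · have h : u.1 * τ u.1 = Nm u₀ := u.2.trans hr
      exact isUnit_of_mul_isUnit_left (h ▸ hN₀)
    · show Ring.inverse (u.1 * τ u.1) + eA + y₀ * gA = Ring.inverse (Nm u₀) + eA + y₀ * gA
      have h : u.1 * τ u.1 = Nm u₀ := u.2.trans hr
      rw [h]
    · apply Subtype.ext; apply Subtype.ext
      have h := w.2
      change Ring.inverse (Nm w.1.1.1) + eA + w.1.1.2 * gA = Ring.inverse (Nm u₀) + eA + y₀ * gA at h
      obtain ⟨-, hY⟩ := fixed_add_mul_frame_inj τ hgAu (hfixZ w.1) (hfixZ ⟨(u₀, y₀), hu₀, hy₀⟩) w.1.2.2 hy₀ h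
      exact Prod.ext rfl hY.symm
  rw [Literature.NumberTheory.Automorphic.UnitaryGroup.natCard_subtype_comp_eq_mul Z G _ hfibre]
  congr 1
  -- Step 2: every `z` with `G z` is in the range of `Z`
  have hrange : ∀ z, G z → z ∈ Set.range Z := by
    intro z hz
    obtain ⟨F, Y, hFfix, hYfix, hzFY⟩ := exists_fixed_add_mul_frame_eq τ hττ hgAu z
    have hGz : ¬ IsUnit ((F + Y * gA) * τ (F + Y * gA) - (eA ^ 2 - 1)) := by
      rw [← hzFY]
      obtain ⟨w, hwz, hdw⟩ := hz
      have hcl : z * τ z - (eA ^ 2 - 1) = Ideal.Quotient.mk (maximalIdeal R ^ m) (w * σ w - p ^ (2 * ℓ) * γ) := by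
        rw [← hwz, hτmk, heA, ← hec, map_sub, map_mul, map_sub, map_pow, map_one]
      have hmem : w * σ w - p ^ (2 * ℓ) * γ ∈ maximalIdeal R := by
        rw [Irreducible.maximalIdeal_eq hp, Ideal.mem_span_singleton]
        exact dvd_trans (dvd_pow_self p (by omega)) hdw
      rw [hcl]
      intro hu
      obtain ⟨v, hv⟩ := Ideal.Quotient.mk_surjective (↑hu.unit⁻¹ : A)
      have h1 : Ideal.Quotient.mk (maximalIdeal R ^ m) ((w * σ w - p ^ (2 * ℓ) * γ) * v) = 1 := by
        rw [map_mul, hv]; exact hu.mul_val_inv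
      rw [← map_one (Ideal.Quotient.mk (maximalIdeal R ^ m)), Ideal.Quotient.eq] at h1
      have h1' : (w * σ w - p ^ (2 * ℓ) * γ) * v - 1 ∈ maximalIdeal R := Ideal.pow_le_self (by omega) h1
      have : (1 : R) ∈ maximalIdeal R := by
        have := Ideal.sub_mem _ (Ideal.mul_mem_right v _ hmem) h1'
        rwa [sub_sub_cancel] at this
      exact (Ideal.ne_top_iff_one _).1 (Ideal.IsMaximal.ne_top (IsLocalRing.maximalIdeal.isMaximal R)) this
    have hFe : IsUnit (F - eA) := isUnit_fixed_sub_of_norm_sub_frame τ hττ hgAu hτe he1 hFfix hYfix hGz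
    set n₁ : A := ↑hFe.unit⁻¹ with hn₁
    have hn₁fix : τ n₁ = n₁ := by
      have h1 : τ (F - eA) = F - eA := by rw [map_sub, hFfix, hτe]
      rw [hn₁]; exact hτinv hFe.unit (by rw [hFe.unit_spec]; exact h1)
    obtain ⟨r₀, hr₀⟩ := Ideal.Quotient.mk_surjective n₁
    have hmem : σ r₀ - r₀ ∈ maximalIdeal R ^ m := by
      rw [← Ideal.Quotient.eq_zero_iff_mem, map_sub, sub_eq_zero, ← hτmk, hr₀, hn₁fix]
    obtain ⟨r, hrfix, hrr⟩ := exists_fixed_sub_mem σ hσ ha hmem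
    have hrn : Ideal.Quotient.mk (maximalIdeal R ^ m) r = n₁ := by
      rw [← hr₀, Ideal.Quotient.eq]; exact hrr
    have hru : IsUnit r := isUnit_of_isUnit_mk_pow (R := R) hm (by rw [hrn, hn₁]; exact Units.isUnit _)
    have hpos : 0 < Nat.card {u : A // u * τ u = Ideal.Quotient.mk _ r} := by
      rw [natCard_norm_fibre_quotient_pow σ hσ ha hq hm hru hrfix]; exact Nat.mul_pos (pow_pos hq0 _) (Nat.succ_pos q)
    obtain ⟨⟨u, hu⟩⟩ := Nat.card_pos_iff.1 hpos |>.1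
    rw [hrn] at hu
    have huunit : IsUnit u := isUnit_of_mul_isUnit_left (by rw [show u * τ u = n₁ from hu, hn₁]; exact Units.isUnit _)
    refine ⟨⟨(u, Y), huunit, hYfix⟩, ?_⟩
    show Ring.inverse (u * τ u) + eA + Y * gA = z
    rw [show u * τ u = n₁ from hu, hn₁, Ring.inverse_unit, inv_inv, hFe.unit_spec, sub_add_cancel, hzFY]
  rw [Nat.card_congr (Equiv.subtypeEquivRight fun z => (and_iff_right_of_imp (hrange z) : z ∈ Set.range Z ∧ G z ↔ G z))]
  -- Step 3: the `z`-count
  exact natCard_norm_congr_shift_exists σ hσ ha hq hp hσp hj hjm hγ hσγ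

end Count

end Literature.NumberTheory.LocalFields.UnramifiedQuadraticNorm
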